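import Summits.ResolutionOfSingularities.ResolutionOfSingularities.Theorems.WeightedInvariantHypersurfaceLocalGameEFT4SDimLETwoOpenFinal
import Summits.ResolutionOfSingularities.ResolutionOfSingularities.Theorems.WeightedInvariantHypersurfaceLocalGameEFT4SDimOneGame
import Summits.ResolutionOfSingularities.ResolutionOfSingularities.Theorems.WeightedInvariantEssSmoothLocalHomOrder
import Summits.ResolutionOfSingularities.ResolutionOfSingularities.Theorems.WeightedInvariantWeightedChartPrimaryLocal
import Summits.ResolutionOfSingularities.ResolutionOfSingularities.Theorems.WeightedInvariantWeightedConstructionWeightedChartBasicOpen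
import Summits.ResolutionOfSingularities.ResolutionOfSingularities.Theorems.WeightedInvariantWeightedConstructionCobordantBlowupRegular
import Literature.AlgebraicGeometry.Resolution.RegularQuotientIdeal
import Literature.AlgebraicGeometry.Resolution.RegularLocalRingsProofs
import HarnessLib

/-!
# The cylinder rule is compatible with essentially smooth local homomorphisms — (P3a-2) of ORDER (o28)
# (door `HypersurfaceCentreConstruction`, stmt-ResolutionOfSingularities-19897; KEY `stub_localWeightedDropEFT4S` beyond the
# P2 rung, regime P3a «the top stratum is a regular germ of codimension two»; res-type-005, res-L1-w43-plan-1 2026-08-27T09:31:23Z)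

Topic: `Summits/ResolutionOfSingularities/ResolutionOfSingularities/Theorems`. Helper for the door item
`HypersurfaceCentreConstruction` (stmt-ResolutionOfSingularities-19897, route `WeightedInvariant`).

THE CYLINDER RULE reads the P2 centre filtration `jContact` (res-type-092, p514802) at the generic point of the top stratum:
at a regular local position `R` with stratum prime `P` (`R/P` regular, `R_P` regular local of Krull dimension `2`),
`J(R, f, m) := (jContact (R_P) f m) ∩ R`.  The recorded dead end of the naive recipe «recompute `jContact` in `S'`» is the
essentially smooth local homomorphism `S → S' = S[t]_(𝔪, t)` of relative dimension one: the (c11) clause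
`IotaJEssSmoothCompatible` demands `J(S') = J(S)·S'`, and the `𝔪'`-based `jContact S'` is not that.  MAIN THEOREM
(`ContactCylinder.cylinder_comap_eq_map`): for every essentially smooth local homomorphism `S → S'` of regular local rings with
`dim S ≤ 2` and `𝔭' := 𝔪_S S'` prime (it always is: the closed fibre is a regular local ring, res-type-070 p507256), the cylinder
value `(jContact (S'_{𝔭'}) f m) ∩ S'` EQUALS `(jContact S f m)·S'` and `ι` is read at `S'_{𝔭'}` — conditional only on the
P2 clause (c11)↾≤2 `IotaJEssSmoothCompatibleLE2 iotaOrd jContact` (res-type-078's (o24-C), hypothesis `hC`), applied to the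
dimension-preserving composite `S → S'_{𝔭'}`.  Route: the values of `jContact` in dimension `≤ 2` are `⊥`, `⊤` or ONE weighted
monomial ideal on part of a regular system of parameters with positive weights (`jContact_eq_cases`); a regular system of
parameters of `S` maps to a family with independent differentials in `S'` (`linearIndependent_toCotangent_map`, by counting:
`ht 𝔭' = dim S'_{𝔭'} = dim S` via flatness, against an independent generating family of `𝔭'` selected from the images —
Literature `exists_span_eq_of_isRegularLocalRing_quotient`); weighted pieces on such a family are primary for a prime inside
`𝔭'` (stub-10, p508751 family), hence contracted from `S'_{𝔭'}` (Mathlib `IsLocalization.under_map_of_isPrimary_disjoint`).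
[OURS · L1 W4.3 · (o28) P3a probe]  Replaces the role of NO printed item; NOT a statement of the manuscript
[claim: Hironaka2017, status: under-review]. AI work, weaker than expert review.

## References

* H. Matsumura, Commutative Ring Theory (1987), Thm. 14.2, 15.1, 16.2, 19.3, 23.7. [Matsumura1987]
* V. Cossart, U. Jannsen, S. Saito, LNM 2270 (2020), Ch. 8 (maximal contact in dimension two). [CossartJannsenSaito2020]
-/

noncomputable section

open IsLocalRing Literature.AlgebraicGeometry.Resolution
open Summit.ResolutionOfSingularities.ResolutionOfSingularities.Cruxes.HypersurfaceCentreConstruction.LocalEngine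

set_option linter.dupNamespace false -- mandated namespace of this single-conjunct summit

namespace Summit.ResolutionOfSingularities.ResolutionOfSingularities.Theorems

namespace ContactCylinder

/-! ## The composite `S → S' → S'_{𝔭'}` -/

section Tower

variable {S S' : Type} [CommRing S] [CommRing S'] [Algebra S S'] (𝔭' : Ideal S') [𝔭'.IsPrime]

/-- `S → S'_{𝔭'}` is a local homomorphism when `𝔪_S S' ≤ 𝔭'`. [folklore] -/
theorem isLocalHom_atPrime [IsLocalRing S] (h𝔭' : (maximalIdeal S).map (algebraMap S S') ≤ 𝔭') :
    IsLocalHom (algebraMap S (Localization.AtPrime 𝔭')) := by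
  refine ⟨fun a ha => ?_⟩
  by_contra hna
  have hmem : algebraMap S S' a ∈ 𝔭' :=
    h𝔭' (Ideal.mem_map_of_mem _ ((IsLocalRing.mem_maximalIdeal a).mpr hna))
  have hT : algebraMap S (Localization.AtPrime 𝔭') a ∈ maximalIdeal (Localization.AtPrime 𝔭') := by
    rw [IsScalarTower.algebraMap_apply S S' (Localization.AtPrime 𝔭')]
    exact (IsLocalization.AtPrime.to_map_mem_maximal_iff (Localization.AtPrime 𝔭') 𝔭' _).mpr hmem
  exact (IsLocalRing.mem_maximalIdeal _).mp hT ha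

/-- **The composite `S → S'_{𝔪S'}` preserves the dimension**: for an essentially smooth local homomorphism `S → S'` of
Noetherian local rings, `S` regular, and `𝔭' = 𝔪_S S'` prime, `dim S'_{𝔭'} = dim S` (flatness, res-type-070's
`flat_of_formallySmooth_of_essFiniteType`, and the dimension formula `ht 𝔪_T = ht 𝔪_S + dim T/𝔪_S T` with `𝔪_S T = 𝔪_T`).
[cite: Matsumura1987, Thm. 15.1] -/
theorem ringKrullDim_atPrime_eq [IsRegularLocalRing S] [IsNoetherianRing S'] [IsLocalRing S'] [IsLocalHom (algebraMap S S')]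
    [Algebra.FormallySmooth S S'] [Algebra.EssFiniteType S S'] (h𝔭' : (maximalIdeal S).map (algebraMap S S') = 𝔭') :
    ringKrullDim (Localization.AtPrime 𝔭') = ringKrullDim S := by
  haveI : IsLocalHom (algebraMap S (Localization.AtPrime 𝔭')) := isLocalHom_atPrime 𝔭' h𝔭'.le
  haveI : Algebra.FormallySmooth S (Localization.AtPrime 𝔭') :=
    Algebra.FormallySmooth.comp S S' (Localization.AtPrime 𝔭')
  haveI : Algebra.EssFiniteType S (Localization.AtPrime 𝔭') :=
    Algebra.EssFiniteType.comp S S' (Localization.AtPrime 𝔭')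
  haveI : Module.Flat S (Localization.AtPrime 𝔭') := flat_of_formallySmooth_of_essFiniteType S (Localization.AtPrime 𝔭')
  have hmax : (maximalIdeal S).map (algebraMap S (Localization.AtPrime 𝔭')) = maximalIdeal (Localization.AtPrime 𝔭') := by
    rw [IsScalarTower.algebraMap_eq S S' (Localization.AtPrime 𝔭'), ← Ideal.map_map, h𝔭',
      Localization.AtPrime.map_eq_maximalIdeal]
  have h' := Ideal.height_eq_height_add_of_liesOver_of_hasGoingDown (maximalIdeal S)
    (maximalIdeal (Localization.AtPrime 𝔭'))
  rw [hmax, Ideal.map_quotient_self, Ideal.height_bot, add_zero] at h'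
  rw [← IsLocalRing.maximalIdeal_height_eq_ringKrullDim, ← IsLocalRing.maximalIdeal_height_eq_ringKrullDim, h']

end Tower

/-! ## Weighted pieces on part of a regular system of parameters are contracted from any prime above their radical -/

/-- **`(u; w)_m S'_{𝔭'} ∩ S' = (u; w)_m`** for `u ⊆ 𝔭'` with independent differentials, positive weights `w` and `m ≥ 1`
(stub-10's `isPrimary_span_weightedMonomials_of_linearIndependent_toCotangent`: the piece is primary with radical `(u) ≤ 𝔭'`;
Mathlib `IsLocalization.under_map_of_isPrimary_disjoint`). [cite: Matsumura1987, Thm. 16.2] -/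
theorem comap_map_weightedMonomialIdeal_eq_of_linearIndependent {S' : Type} [CommRing S'] [IsRegularLocalRing S']
    (𝔭' : Ideal S') [𝔭'.IsPrime] {N : ℕ} (u : Fin N → S') (hu : ∀ i, u i ∈ maximalIdeal S')
    (hli : LinearIndependent (ResidueField S') (fun i => (maximalIdeal S').toCotangent ⟨u i, hu i⟩))
    (hu𝔭 : ∀ i, u i ∈ 𝔭') (w : Fin N → ℕ) (hw : ∀ i, 0 < w i) {m : ℕ} (hm : 1 ≤ m) :
    ((weightedMonomialIdeal u w m).map (algebraMap S' (Localization.AtPrime 𝔭'))).comap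
        (algebraMap S' (Localization.AtPrime 𝔭')) = weightedMonomialIdeal u w m := by
  rw [weightedMonomialIdeal_eq_span_weightedMonomials]
  obtain ⟨hprim, hrad⟩ := isPrimary_span_weightedMonomials_of_linearIndependent_toCotangent u hu hli w hw hm
  have hle : Ideal.span (Set.range u) ≤ 𝔭' := Ideal.span_le.mpr (by rintro _ ⟨i, rfl⟩; exact hu𝔭 i)
  have hdisj : Disjoint (𝔭'.primeCompl : Set S') (Ideal.span (weightedMonomials u w m) : Set S') :=
    Set.disjoint_left.mpr fun s hs hsQ => hs (hle (hrad ▸ Ideal.le_radical hsQ))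
  exact IsLocalization.under_map_of_isPrimary_disjoint 𝔭'.primeCompl (Localization.AtPrime 𝔭') hprim hdisj

/-! ## A regular system of parameters keeps independent differentials along `S → S'` -/

/-- **Images of a regular system of parameters have independent differentials.**  `S → S'` a local homomorphism of
regular local rings with `𝔭' = 𝔪_S S'` prime, `S'/𝔭'` regular and `dim S'_{𝔭'} = dim S`; `y` a minimal system of
generators of `𝔪_S`.  Then the images of the `yᵢ` have linearly independent classes in `𝔪'/𝔪'²`: an independent generating
family of `𝔭'` can be selected from them (Literature `exists_span_eq_of_isRegularLocalRing_quotient`), of length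
`≥ ht 𝔭' = dim S` (Krull) and `≤ dim S`, so it is all of them. [cite: Matsumura1987, Thm. 14.2] -/
theorem linearIndependent_toCotangent_map {S S' : Type} [CommRing S] [IsRegularLocalRing S] [CommRing S']
    [IsRegularLocalRing S'] [Algebra S S'] [IsLocalHom (algebraMap S S')] (𝔭' : Ideal S') [𝔭'.IsPrime]
    (h𝔭' : (maximalIdeal S).map (algebraMap S S') = 𝔭') [IsRegularLocalRing (S' ⧸ 𝔭')]
    (hT : ringKrullDim (Localization.AtPrime 𝔭') = ringKrullDim S)
    {d : ℕ} (y : Fin d → S) (hy : Ideal.span (Set.range y) = maximalIdeal S) (hd : (maximalIdeal S).spanFinrank = d) :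
    LinearIndependent (ResidueField S') (fun i => (maximalIdeal S').toCotangent
      ⟨algebraMap S S' (y i), map_nonunit (algebraMap S S') (y i) (hy ▸ Ideal.subset_span ⟨i, rfl⟩)⟩) := by
  classical
  have hG : Ideal.span (Set.range (fun i => algebraMap S S' (y i))) = 𝔭' := by
    rw [← h𝔭', ← hy, Ideal.map_span, ← Set.range_comp]
    rfl
  have h𝔭'le : 𝔭' ≤ maximalIdeal S' := IsLocalRing.le_maximalIdeal (Ideal.IsPrime.ne_top ‹_›)
  obtain ⟨c, fv, hfG, hspan, hli⟩ :=
    exists_span_eq_of_isRegularLocalRing_quotient h𝔭'le (Set.range fun i => algebraMap S S' (y i)) hG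
  choose σ hσ using fun i => Set.mem_range.mp (hfG i)
  have hfv_inj : Function.Injective fv := injective_of_linearIndependent_toCotangent fv _ hli
  have hσ_inj : Function.Injective σ := by
    intro i j hij
    apply hfv_inj
    rw [← hσ i, ← hσ j, hij]
  -- `c = d`
  have hcd : c ≤ d := by simpa using Fintype.card_le_of_injective σ hσ_inj
  have hdc : d ≤ c := by
    have h1 : ((𝔭'.height : ℕ∞) : WithBot ℕ∞) = ((d : ℕ∞) : WithBot ℕ∞) := by
      rw [← IsLocalization.AtPrime.ringKrullDim_eq_height 𝔭' (Localization.AtPrime 𝔭'), hT,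
        ← IsRegularLocalRing.spanFinrank_maximalIdeal, hd]
      rfl
    have h1' : 𝔭'.height = (d : ℕ∞) := WithBot.coe_eq_coe.mp h1
    have h2 : 𝔭'.height ≤ (𝔭'.spanFinrank : ℕ∞) := Ideal.height_le_spanFinrank 𝔭' (Ideal.IsPrime.ne_top ‹_›)
    have h3 : 𝔭'.spanFinrank ≤ c := by
      rw [← hspan]
      calc (Ideal.span (Set.range fv)).spanFinrank ≤ (Set.range fv).ncard :=
            Submodule.spanFinrank_span_le_ncard_of_finite (Set.finite_range fv)
        _ = c := by rw [Set.ncard_range_of_injective hfv_inj, Nat.card_eq_fintype_card, Fintype.card_fin]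
    rw [h1'] at h2
    exact (by exact_mod_cast h2 : d ≤ 𝔭'.spanFinrank).trans h3
  obtain rfl : c = d := le_antisymm hcd hdc
  -- `σ` is a bijection; the target family is `fv ∘ σ⁻¹` up to proof-irrelevant subtype equality
  have hbij : Function.Bijective σ := (Fintype.bijective_iff_injective_and_card σ).mpr ⟨hσ_inj, rfl⟩
  set e := Equiv.ofBijective σ hbij with he
  have hfam : (fun i => (maximalIdeal S').toCotangent
      ⟨algebraMap S S' (y i), map_nonunit (algebraMap S S') (y i) (hy ▸ Ideal.subset_span ⟨i, rfl⟩)⟩) =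
      (fun j => (maximalIdeal S').toCotangent ⟨fv j, h𝔭'le (hspan ▸ Ideal.subset_span ⟨j, rfl⟩)⟩) ∘ e.symm := by
    funext i
    simp only [Function.comp_apply]
    congr 1
    apply Subtype.ext
    change algebraMap S S' (y i) = fv (e.symm i)
    rw [← hσ (e.symm i)]
    congr 1
    exact congrArg y (Equiv.ofBijective_apply_symm_apply σ hbij i).symm
  rw [hfam]
  exact hli.comp _ e.symm.injective

/-! ## The values of `jContact` in dimension `≤ 2` -/

/-- **A regular parameter is a member of a regular system of parameters** (dimension `≤ 2`): for `π ∈ 𝔪 ∖ 𝔪²` there is a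
minimal system of generators `y` of `𝔪` with `π` among the `yᵢ` (a DVR: `(π) = 𝔪`; dimension two: the exchange lemma
`exists_span_pair_eq_maximalIdeal_of_not_mem_sq`, p518517). [cite: Matsumura1987, Thm. 14.2] -/
theorem exists_rsp_through {S : Type} [CommRing S] [IsRegularLocalRing S] (hS : ringKrullDim S ≤ 2) {π : S}
    (hπ : π ∈ maximalIdeal S) (hπ2 : π ∉ maximalIdeal S ^ 2) :
    ∃ (d : ℕ) (y : Fin d → S) (i : Fin d), Ideal.span (Set.range y) = maximalIdeal S ∧
      (maximalIdeal S).spanFinrank = d ∧ y i = π := by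
  classical
  haveI := isDomain_of_isRegularLocalRing S
  have hsf := IsRegularLocalRing.spanFinrank_maximalIdeal (R := S)
  have hd2 : (maximalIdeal S).spanFinrank ≤ 2 := by
    have : ((maximalIdeal S).spanFinrank : WithBot ℕ∞) ≤ 2 := by rw [hsf]; exact hS
    exact_mod_cast this
  have hd0 : (maximalIdeal S).spanFinrank ≠ 0 := by
    intro h0
    have hbot : maximalIdeal S = ⊥ := (Submodule.spanFinrank_eq_zero_iff_eq_bot (IsNoetherian.noetherian _)).mp h0
    rw [hbot, Ideal.mem_bot] at hπ
    exact hπ2 (by rw [hπ]; exact Ideal.zero_mem _)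
  rcases Nat.lt_or_ge (maximalIdeal S).spanFinrank 2 with hlt | hge
  · -- dimension one: a DVR, `(π) = 𝔪`
    have h1 : (maximalIdeal S).spanFinrank = 1 := by omega
    have hdim1 : ringKrullDim S = 1 := by rw [← hsf, h1]; rfl
    haveI : IsDiscreteValuationRing S :=
      Literature.RingTheory.RegularLocalRing.isDiscreteValuationRing_of_ringKrullDim_eq_one hdim1
    obtain ⟨ϖ, hirr⟩ := IsDiscreteValuationRing.exists_irreducible S
    have h𝔪 : maximalIdeal S = Ideal.span {ϖ} := (IsDiscreteValuationRing.irreducible_iff_uniformizer ϖ).mp hirr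
    have hπ0 : π ≠ 0 := by rintro rfl; exact hπ2 (Ideal.zero_mem _)
    obtain ⟨k, υ, hπυ⟩ := IsDiscreteValuationRing.eq_unit_mul_pow_irreducible hπ0 hirr
    have hk : k = 1 := by
      rcases Nat.lt_trichotomy k 1 with hk | hk | hk
      · exfalso
        have : k = 0 := by omega
        rw [this, pow_zero, mul_one] at hπυ
        exact (IsLocalRing.mem_maximalIdeal _).mp hπ (hπυ ▸ υ.isUnit)
      · exact hk
      · exfalso
        apply hπ2
        rw [hπυ, h𝔪]
        exact Ideal.mul_mem_left _ _ (Ideal.pow_le_pow_right hk (Ideal.pow_mem_pow (Ideal.mem_span_singleton_self ϖ) k))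
    refine ⟨1, fun _ => π, 0, ?_, h1, rfl⟩
    have hrange : Set.range (fun _ : Fin 1 => π) = {π} := by
      ext z; simp [eq_comm]
    rw [hrange, h𝔪, hπυ, hk, pow_one]
    exact Ideal.span_singleton_mul_left_unit υ.isUnit ϖ
  · -- dimension two
    have h2 : (maximalIdeal S).spanFinrank = 2 := le_antisymm hd2 hge
    have hdim2 : ringKrullDim S = 2 := by rw [← hsf, h2]; rfl
    obtain ⟨x, -, hxπ⟩ := GenericEquimultiplicity.exists_span_pair_eq_maximalIdeal_of_not_mem_sq hdim2 hπ hπ2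
    refine ⟨2, ![x, π], 1, ?_, h2, rfl⟩
    have hrange : Set.range ![x, π] = {x, π} := by
      rw [Matrix.range_cons, Matrix.range_cons, Matrix.range_empty, Set.union_empty, Set.singleton_union]
    rw [hrange, hxπ]

/-- **The values of the centre filtration in Krull dimension `≤ 2`** are `⊥` (`f = 0`), `⊤` (units, `m = 0`), or ONE
weighted monomial ideal `(y ∘ σ; w)_m` on a sub-family `σ` of a minimal system of generators `y` of `𝔪` with POSITIVE
weights: `(π)^m` at monomial type (092's `radical_span_unit_mul_pow`), `F_{g,b_max}(m) = (x, g; 1, b_max)_m` when a contact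
parameter reaches the terminal level (092's `jContact_eq_contactFiltration` + C1), `𝔪^m = (x, y; 1, 1)_m` otherwise.
[OURS · L1 W4.3 · (o28)] -/
theorem jContact_eq_cases (S : Type) [CommRing S] [IsRegularLocalRing S] (hS : ringKrullDim S ≤ 2) (f : S) (m : ℕ) :
    jContact S f m = ⊥ ∨ jContact S f m = ⊤ ∨
      ∃ (d : ℕ) (y : Fin d → S) (_ : Ideal.span (Set.range y) = maximalIdeal S) (_ : (maximalIdeal S).spanFinrank = d)
        (N : ℕ) (σ : Fin N → Fin d) (_ : Function.Injective σ) (w : Fin N → ℕ),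
        (∀ i, 0 < w i) ∧ 1 ≤ m ∧ jContact S f m = weightedMonomialIdeal (y ∘ σ) w m := by
  classical
  haveI := isDomain_of_isRegularLocalRing S
  have hsf := IsRegularLocalRing.spanFinrank_maximalIdeal (R := S)
  by_cases hf0 : f = 0
  · left
    rw [jContact_eq]
    unfold jContactLocal
    rw [if_pos hf0]
  by_cases hu : IsUnit f
  · right; left
    rw [jContact_eq]
    unfold jContactLocal
    rw [if_neg hf0, if_pos hu]
  rcases Nat.eq_zero_or_pos m with rfl | hm
  · right; left
    rw [jContact_eq]
    unfold jContactLocal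
    rw [if_neg hf0, if_neg hu]
    split_ifs
    · rw [pow_zero, Ideal.one_eq_top]
    · rw [pow_zero, Ideal.one_eq_top, top_sup_eq]
  right; right
  have hf𝔪 : f ∈ maximalIdeal S := (IsLocalRing.mem_maximalIdeal f).mpr hu
  by_cases hmono : IsMonomialType f
  · -- `(π)^m`
    obtain ⟨v, π, ν, hv, hπ, hπ2, hfe⟩ := hmono
    have hν : 1 ≤ ν := by
      rcases Nat.eq_zero_or_pos ν with h0 | h
      · exfalso
        apply hu
        rw [hfe, h0, pow_zero, mul_one]
        exact hv
      · exact h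
    have hval : jContact S f m = Ideal.span {π} ^ m := by
      rw [jContact_eq]
      unfold jContactLocal
      rw [if_neg hf0, if_neg hu, if_pos ⟨v, π, ν, hv, hπ, hπ2, hfe⟩, hfe, radical_span_unit_mul_pow hv hπ hπ2 hν]
    obtain ⟨d, y, i, hy, hd, hyi⟩ := exists_rsp_through hS hπ hπ2
    refine ⟨d, y, hy, hd, 1, fun _ => i, fun a b _ => Subsingleton.elim a b, fun _ => 1, fun _ => Nat.one_pos, hm, ?_⟩
    rw [hval]
    have hcomp : (y ∘ fun _ : Fin 1 => i) = fun _ : Fin 1 => π := by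
      funext j
      simp [hyi]
    rw [hcomp, LocalGameEFT4SDimOne.weightedMonomialIdeal_one_eq, Ideal.span_singleton_pow]
  · -- not of monomial type: `f ∈ 𝔪²`, dimension exactly two
    have hf2 : f ∈ maximalIdeal S ^ 2 := by
      by_contra hf2
      exact hmono ⟨1, f, 1, isUnit_one, hf𝔪, hf2, by rw [one_mul, pow_one]⟩
    have hd2 : (maximalIdeal S).spanFinrank = 2 := by
      have hdle : (maximalIdeal S).spanFinrank ≤ 2 := by
        have : ((maximalIdeal S).spanFinrank : WithBot ℕ∞) ≤ 2 := by rw [hsf]; exact hS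
        exact_mod_cast this
      rcases Nat.lt_or_ge (maximalIdeal S).spanFinrank 2 with hlt | hge
      · exfalso
        refine hmono (GenericEquimultiplicity.isMonomialType_of_ringKrullDim_le_one ?_ hf0 hf2)
        rw [← hsf]
        exact_mod_cast Nat.lt_succ_iff.mp hlt
      · exact le_antisymm hdle hge
    have hdim2 : ringKrullDim S = 2 := by rw [← hsf, hd2]; rfl
    have hrange : ∀ x g : S, Set.range ![x, g] = {x, g} := fun x g => by
      rw [Matrix.range_cons, Matrix.range_cons, Matrix.range_empty, Set.union_empty, Set.singleton_union]
    -- a presentation `(x, g; 1, b)_m` with `span {x, g} = 𝔪`, `b ≥ 1`, suffices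
    suffices h : ∃ (x g : S) (b : ℕ), Ideal.span {x, g} = maximalIdeal S ∧ 1 ≤ b ∧
        jContact S f m = weightedMonomialIdeal ![x, g] ![1, b] m by
      obtain ⟨x, g, b, hxg, hb, hval⟩ := h
      refine ⟨2, ![x, g], by rw [hrange, hxg], hd2, 2, id, Function.injective_id, ![1, b], ?_, hm, ?_⟩
      · intro i
        fin_cases i
        · exact Nat.one_pos
        · exact hb
      · rw [hval]
        rfl
    by_cases hreach : ∃ g : S, g ∈ maximalIdeal S ∧ g ∉ maximalIdeal S ^ 2 ∧
        f ∈ contactFiltration g (bMax f) (bMax f * (adicOrder f).toNat)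
    · -- a contact parameter reaches the terminal level: `F_{g, b_max}(m)`
      obtain ⟨g, hg, hg2, hfg⟩ := hreach
      have hval : jContact S f m = contactFiltration g (bMax f) m :=
        jContact_eq_contactFiltration S hf0 hmono hg hg2 hfg m
      obtain ⟨x, -, hxg⟩ := GenericEquimultiplicity.exists_span_pair_eq_maximalIdeal_of_not_mem_sq hdim2 hg hg2
      rcases Nat.eq_zero_or_pos (bMax f) with hb0 | hb
      · refine ⟨x, g, 1, hxg, le_rfl, ?_⟩
        rw [hval, hb0, contactFiltration_zero_weight, ← contactFiltration_one_weight hg m, contactFiltration_def,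
          ContactFiltration.weightedMonomialIdeal_eq_contactFiltration hxg le_rfl]
      · refine ⟨x, g, bMax f, hxg, hb, ?_⟩
        rw [hval, contactFiltration_def, ContactFiltration.weightedMonomialIdeal_eq_contactFiltration hxg hb]
    · -- no contact parameter reaches the level: `𝔪^m`
      have hval : jContact S f m = maximalIdeal S ^ m := by
        rw [jContact_eq]
        unfold jContactLocal
        rw [if_neg hf0, if_neg hu, if_neg hmono]
        have hbot : (⨆ (g : S) (_ : g ∈ maximalIdeal S ∧ g ∉ maximalIdeal S ^ 2 ∧
            f ∈ contactFiltration g (bMax f) (bMax f * (adicOrder f).toNat)),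
            contactFiltration g (bMax f) m) = ⊥ :=
          iSup_eq_bot.mpr fun g => iSup_eq_bot.mpr fun h => absurd ⟨g, h⟩ hreach
        rw [hbot, sup_bot_eq]
      obtain ⟨x, g, h𝔪, -⟩ := exists_maximalIdeal_eq_span_pair (R := S) hdim2
      have hg : g ∈ maximalIdeal S := h𝔪 ▸ Ideal.subset_span (by simp)
      refine ⟨x, g, 1, h𝔪.symm, le_rfl, ?_⟩
      rw [hval, ← contactFiltration_one_weight hg m, contactFiltration_def,
        ContactFiltration.weightedMonomialIdeal_eq_contactFiltration h𝔪.symm le_rfl]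

/-! ## (P3a-2) COMPATIBILITY -/

/-- **(P3a-2) — the cylinder rule repairs (c11) on the dead-end model.**  Let `S → S'` be an essentially smooth local
homomorphism of regular local rings (local, formally smooth, essentially of finite type), `dim S ≤ 2`, and `𝔭' = 𝔪_S S'`
prime (the model: `S' = S[t]_(𝔪, t)`, `𝔭' = 𝔪S'`, `S'/𝔭' = κ[t]_(t)`, `S'_{𝔭'} = S(t)`).  Then, conditional on the P2
clause `IotaJEssSmoothCompatibleLE2 iotaOrd jContact` ((o24-C), res-type-078): `ι` is read at `S'_{𝔭'}`
(`iotaOrd (S'_{𝔭'}) f = iotaOrd S f`) and the CYLINDER VALUE `(jContact (S'_{𝔭'}) f m) ∩ S'` IS the (c11)-forced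
extension `(jContact S f m)·S'` for every `m`. [OURS · L1 W4.3 · (o28) P3a-2] -/
theorem cylinder_comap_eq_map (hC : IotaJEssSmoothCompatibleLE2 iotaOrd jContact)
    (S S' : Type) [CommRing S] [IsRegularLocalRing S] [CommRing S'] [IsRegularLocalRing S'] [Algebra S S']
    [IsLocalHom (algebraMap S S')] [Algebra.FormallySmooth S S'] [Algebra.EssFiniteType S S']
    (hS : ringKrullDim S ≤ 2) (𝔭' : Ideal S') [𝔭'.IsPrime] (h𝔭' : (maximalIdeal S).map (algebraMap S S') = 𝔭')
    (f : S) :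
    iotaOrd (Localization.AtPrime 𝔭') (algebraMap S (Localization.AtPrime 𝔭') f) = iotaOrd S f ∧
    ∀ m : ℕ, (jContact (Localization.AtPrime 𝔭') (algebraMap S (Localization.AtPrime 𝔭') f) m).comap
        (algebraMap S' (Localization.AtPrime 𝔭')) = (jContact S f m).map (algebraMap S S') := by
  classical
  haveI := isDomain_of_isRegularLocalRing S'
  haveI : IsRegularLocalRing (Localization.AtPrime 𝔭') := isRegularLocalRing_localization_atPrime S' 𝔭'
  haveI : IsLocalHom (algebraMap S (Localization.AtPrime 𝔭')) := isLocalHom_atPrime 𝔭' h𝔭'.le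
  haveI : Algebra.FormallySmooth S (Localization.AtPrime 𝔭') :=
    Algebra.FormallySmooth.comp S S' (Localization.AtPrime 𝔭')
  haveI : Algebra.EssFiniteType S (Localization.AtPrime 𝔭') :=
    Algebra.EssFiniteType.comp S S' (Localization.AtPrime 𝔭')
  have hT : ringKrullDim (Localization.AtPrime 𝔭') = ringKrullDim S := ringKrullDim_atPrime_eq 𝔭' h𝔭'
  have hT2 : ringKrullDim (Localization.AtPrime 𝔭') ≤ 2 := by rw [hT]; exact hS
  obtain ⟨hι, hJ⟩ := hC S (Localization.AtPrime 𝔭') f hT2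
  refine ⟨hι, fun m => ?_⟩
  rw [hJ m, IsScalarTower.algebraMap_eq S S' (Localization.AtPrime 𝔭'), ← Ideal.map_map]
  haveI : IsRegularLocalRing (S' ⧸ 𝔭') := by
    rw [← h𝔭']
    exact isRegularLocalRing_fiber S S'
  rcases jContact_eq_cases S hS f m with h0 | htop | ⟨d, y, hy, hd, N, σ, hσ, w, hw, hm, hval⟩
  · rw [h0, Ideal.map_bot, Ideal.map_bot]
    exact Ideal.comap_bot_of_injective _
      (IsLocalization.injective (Localization.AtPrime 𝔭') 𝔭'.primeCompl_le_nonZeroDivisors)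
  · rw [htop, Ideal.map_top, Ideal.map_top, Ideal.comap_top]
  · rw [hval, weightedMonomialIdeal_map]
    have hli := linearIndependent_toCotangent_map 𝔭' h𝔭' hT y hy hd
    have hsub := linearIndependent_toCotangent_comp (fun i => algebraMap S S' (y i)) _ hli σ hσ
    have hmem : ∀ i, algebraMap S S' ((y ∘ σ) i) ∈ 𝔭' := fun i =>
      h𝔭' ▸ Ideal.mem_map_of_mem (algebraMap S S') (hy ▸ Ideal.subset_span ⟨σ i, rfl⟩)
    exact comap_map_weightedMonomialIdeal_eq_of_linearIndependent 𝔭' (fun i => algebraMap S S' ((y ∘ σ) i)) _ hsub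
      hmem w hw hm

end ContactCylinder

end Summit.ResolutionOfSingularities.ResolutionOfSingularities.Theorems

end
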